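import Summits.QuantumFields.BalabanUV.Beta.D1BFx.CellSumTranspose
import Summits.QuantumFields.BalabanUV.Beta.D1BFx.GluonLocalDipRow

/-!
# `BalabanUV.Beta.D1BFx.GluonDipLocalRow` — road «BF-x» for binder row D1, slot (K), END row `hGrp gN`, «T₂-K»: THE `dip ⊗ SbT` PIECE OF THE GLUON
# NEEDLE ROW T₂ IS n-UNIFORM WITH ITS WEIGHT `cK = cgh·n²` INSIDE — `∃ C ≥ 0, ∀ n ≥ 1, |cK n · cellSum n a (dipPiece n a) SbT μ ν| ≤ C`, the hypothesis `hd` of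
# `GluonNeedleGlueT12.h₂_of_pieces` VERBATIM (there for `n ≥ 2`, a fortiori), modulo [B5, Prop. 1.2] ∧ [B5, (1.126)–(1.127)] BY NAME — by «CELLSUM-TRANSPOSE» from T₁-K

HONEST DEPENDENCY (cell records, verbatim): «continuum YM on T⁴ ⇐ BetaPertH ∧ nine spine estimates (0/9 proved); BetaPertH ⇐ (D1) ∧ (D4) ∧
CAP+tail; G-an2-4 gates asym, D1 and NE2/3/4.»  HONEST FRAMING (cell contract, verbatim): «discharging `BetaPertH` makes Bałaban's UV stability
UNCONDITIONAL — a real constructive-QFT result; it is NOT the continuum limit and NOT the Clay problem.»  THIS MODULE DISCHARGES NOTHING of the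
wall: a two-line [folklore] corollary of `CellSumTranspose.cellSum_transpose` (with `exists_biLoc_dipPiece` ∕ `exists_biLoc_SbT`, `dipPiece_translate_block` ∕
`SbT_translate_block`, `spr_Ga_of_prop12`) and T₁-K `GluonLocalDipRow.exists_locDip_row_le` at `(ν, μ)`; the two printed statements enter ONLY through the latter's
letters and the leg's spread, BY NAME.  No `def`, no `def … : Prop`, nothing cited, 0 sorry.  Root-level binders hW ∕ hR-sockets ∕ hSX-socket ∕ D1Tel ∕ D1Rep —
0 discharged; (K) NOT closed; NOT D1, NOT `BetaPertH`, NOT continuum, NOT Clay.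

ABSOLUTE RULE (cell charter, verbatim): «No internally-minted statement may enter as a cited fact. Every hypothesis is either kernel-proved in
this package or a verbatim quotation of a PUBLISHED theorem with page reference. The manuscript(s) under audit are NOT citable for their own
disputed steps — they are the thing under adjudication; programme-internal (2001/route/tribunal) claims are never citable.»

WHY (owner d1-p2-g11 l.31387 «T₂-K first refusal leaf-03-g13 after GN-K»; leaf-03-g13 INTENT-B l.31595): `cellSum n a (dipPiece n a) SbT μ ν = cellSum n a SbT
(dipPiece n a) ν μ` (the two readings of one block-periodic two-point function against the even weight), and the right side is T₁-K.
* [folklore] **`cellSum_dip_SbT_eq`**, **`exists_dipLoc_row_le`**.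
Unit `b2b-balaban-beta-d1-formalise-leaf-03` (gen 13), D1 formalisation swarm, road «BF-x»; `LEAVES-BFx.md` row (N) «T₂-K».
-/

noncomputable section

namespace Summit.QuantumFields.BalabanUV.Beta.D1BFx.GluonDipLocalRow

open Literature.MathematicalPhysics.QuantumFieldTheory.Balaban1983to89
open Literature.MathematicalPhysics.QuantumFieldTheory.Balaban1983to89.Beta
open VectorTailsLoc (fam kfam)
open Summit.QuantumFields.BalabanUV.Beta.TameKernelCalculus (Spr)
open Summit.QuantumFields.BalabanUV.Beta.D1BFx.GluonLeg (Ga)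
open Summit.QuantumFields.BalabanUV.Beta.D1BFx.GluonLegTails (spr_Ga_of_prop12)
open Summit.QuantumFields.BalabanUV.Beta.D1BFx.FrozenLegTails (nOf MOf hn1)
open Summit.QuantumFields.BalabanUV.Beta.D1BFx.SectorRecut (SbT exists_biLoc_SbT)
open Summit.QuantumFields.BalabanUV.Beta.D1BFx.GluonNeedleSplit (dipPiece)
open Summit.QuantumFields.BalabanUV.Beta.D1BFx.GluonNeedleGlue (cellSum exists_biLoc_dipPiece)
open Summit.QuantumFields.BalabanUV.Beta.D1BFx.CellSumTranspose (cellSum_transpose dipPiece_translate_block SbT_translate_block)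
open Summit.QuantumFields.BalabanUV.Beta.D1BFx.GluonLocalDipRow (exists_locDip_row_le)

/-- [folklore] **THE T₂ DIPOLE PIECE IS THE T₁ DIPOLE PIECE WITH THE DIRECTIONS SWAPPED**: `cellSum n a (dipPiece n a) SbT μ ν = cellSum n a SbT (dipPiece n a) ν μ`. -/
theorem cellSum_dip_SbT_eq (n : ℕ) [NeZero n] (a : ℝ) (ha : 0 < a) (hA : Spr (Ga n a)) (μ ν : Fin 4) :
    cellSum n a (dipPiece n a) SbT μ ν = cellSum n a SbT (dipPiece n a) ν μ := by
  obtain ⟨Cd, δd, hδd, hD⟩ := exists_biLoc_dipPiece n a ha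
  obtain ⟨Cs, δs, hδs, hS⟩ := exists_biLoc_SbT
  exact cellSum_transpose n a hA hD hδd hS hδs (fun κ u t => dipPiece_translate_block n a ha κ u t) (fun κ u t => SbT_translate_block n κ u t) μ ν

/-- [folklore] **«T₂-K»: THE `dip ⊗ SbT` PIECE OF T₂ IS n-UNIFORM WITH ITS WEIGHT INSIDE**, modulo [B5, Prop. 1.2] ∧ [B5, (1.126)–(1.127)] BY NAME and the
displayed ray pin `cK n = cgh·n²` (P13) — hypothesis `hd` of `GluonNeedleGlueT12.h₂_of_pieces` (there for `n ≥ 2`, a fortiori); the constant is T₁-K's at `(ν, μ)`. -/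
theorem exists_dipLoc_row_le (a : ℝ) (ha : 0 < a) (h12 : B5.Prop12Printed (fam nOf hn1 MOf a ha)) (h126 : B5.Kernel126_127Printed (kfam nOf MOf))
    {cK : ℕ → ℝ} {cgh : ℝ} (hcK : ∀ n : ℕ, cK n = cgh * (n : ℝ) ^ 2) (μ ν : Fin 4) :
    ∃ C : ℝ, 0 ≤ C ∧ ∀ (n : ℕ) [NeZero n], |cK n * cellSum n a (dipPiece n a) SbT μ ν| ≤ C := by
  obtain ⟨C, hC, h⟩ := exists_locDip_row_le a ha h12 h126 hcK ν μ
  refine ⟨C, hC, fun n _ => ?_⟩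
  rw [cellSum_dip_SbT_eq n a ha (spr_Ga_of_prop12 (a := a) (ha := ha) h12 h126 n) μ ν]
  exact h n

end Summit.QuantumFields.BalabanUV.Beta.D1BFx.GluonDipLocalRow

end
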